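import Summits.ValiantsHypothesis.ValiantsHypothesis.Theorems.KPlusLogSqLawTropicalBThreeRowSharp
import Summits.ValiantsHypothesis.ValiantsHypothesis.Theorems.KPlusLogSqLawTropicalBTwoRowSharpUnsigned

/-!
# Route «KPlusLogSqLaw», crux `TropicalB` (stmt-ValiantsHypothesis-19771) — the RANK-PROFILE ceilings are SIGN-FREE:
# `tropRowD_rankProfile` (all formats) and the UNSIGNED `m = 3` row `T_D(3, K) ≤ 18K − 53` (`K ≥ 4`)

HONEST FRAMING.  Helper toward the registered stubs of the crux `TropicalB` (cell `pub-symmetroid`, seat val-sym-trop-p3 g6, 2026-08-27;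
`--supports … --as helper`).  Super-fat-corner census ceilings (fixed size, many classes), off the window of the crux; nothing here bears on
`TropicalB` in its window, `WeakLifting`, the doors, `MatrixDescartes` (stmt-ValiantsHypothesis-18050) or VP ≠ VNP.

Third file of the «signs cost nothing in the PROVED ceilings» sweep (after `…TropicalBHalfThinUnsigned`, `…TropicalBTwoRowSharpUnsigned`):
the rank-profile law `tropRootLawAt_rankProfile` (val-sym-trop-p4 g2) and its closed-form `m = 3` evaluation `tropRootLawAt_three_sharp`
(`T(3,K) ≤ 18K − 53`, val-sym-trop-p4 g3) use sign alternation only through the injectivity of the chain (`stub_dominantInjective`); an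
UNSIGNED dominant chain (consecutive terms distinct) is injective too (`injective_of_succ_ne`), so both ceilings hold for the unsigned row
`TropRowD` verbatim:

* `tropRowD_rankProfile (m K) : TropRowD m K (∑_r min(m!, π_{m,K}(r)) − 1)`;
* `tropRowD_three_sharp : 4 ≤ K → TropRowD 3 K (18K − 53)`;
* `tropRowD_three_record4 : 4 ≤ K → TropRowD 3 K (min (min (C(K+2,3) − 1) (18K − 53)) (5 + ⌊27(K−1)/2⌋))` — the UNSIGNED `m = 3` ROW OF
  RECORD now coincides with the signed one at every `K`: slope counting for `K ≤ 6`, `18K − 53` at `K = 7, 8, 9` (`73, 91, 109`), the half-thin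
  `⌊(27K−17)/2⌋` from `K = 10` on; floor `10K − 41` (`ThreeRowTenFamily.not_tropRowD`, p495608).
Proof bodies are the signed ones verbatim with the injectivity source swapped (credited; the signed theorems are not restated).
[this cell; counting arguments of val-sym-trop-p4 g2/g3]
-/

set_option linter.dupNamespace false
set_option autoImplicit false

namespace Summit.ValiantsHypothesis.ValiantsHypothesis.Theorems.KPlusLogSqLaw

open Summit.ValiantsHypothesis.ValiantsHypothesis.Theorems.MatrixDescartes.Negative
open Summit.ValiantsHypothesis.ValiantsHypothesis.Theorems.LacunarySymmetroidMatrixDescartes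
open Summit.ValiantsHypothesis.ValiantsHypothesis.Theorems.LacunarySymmetroidMatrixDescartes.TropicalCensus
open Finset

/-- **Rank-profile law, UNSIGNED.**  Every dominant chain of format `(m, K)` with consecutive terms distinct has at most
`∑_{r=0}^{m(K−1)} min(m!, π_{m,K}(r))` terms (`π_{m,K}(r)` = number of multisets of `m` classes with index sum `r`).  Proof =
`tropRootLawAt_rankProfile` (val-sym-trop-p4 g2) with injectivity from `injective_of_succ_ne`. [folklore counting; argument of p4 g2] -/
theorem tropRowD_rankProfile (m K : ℕ) :
    TropRowD m K ((∑ r ∈ range (m * (K - 1) + 1),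
      min m.factorial ((univ.filter fun S : Sym (Fin K) m => ((S : Multiset (Fin K)).map Fin.val).sum = r).card)) - 1) := by
  classical
  intro d v ε n θ p hθ hdom hsucc
  rcases Nat.eq_zero_or_pos K with hK0 | hKpos
  · subst hK0; exact tropRowD_zero m _ d v ε n θ p hθ hdom hsucc
  have hinj : Function.Injective p := injective_of_succ_ne d v ε θ p hθ hdom hsucc
  -- (1) same permutation ⇒ total rank strictly increases (as in `tropRootLawAt_thin`)
  have hkey : ∀ a b : Fin (n + 1), a < b → (p a).1 = (p b).1 → termRank d (p a) < termRank d (p b) := by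
    intro a b hab h1
    have hne : p a ≠ p b := fun h => (ne_of_lt hab) (hinj h)
    have h2 : (p a).2 ≠ (p b).2 := fun h => hne (Prod.ext h1 h)
    obtain ⟨i, hi⟩ := Function.ne_iff.mp h2
    have hpa : p a = ((p a).1, (p a).2) := rfl
    have hpb : p b = ((p a).1, (p b).2) := by rw [h1]
    have hda : IsDominant d v ε (θ a) ((p a).1, (p a).2) := hpa ▸ hdom a
    have hdb : IsDominant d v ε (θ b) ((p a).1, (p b).2) := hpb ▸ hdom b
    have hmono : ∀ j, dRank d ((p a).2 j) ≤ dRank d ((p b).2 j) := by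
      intro j
      by_cases hj : (p a).2 j = (p b).2 j
      · rw [hj]
      · exact (dRank_lt_of_lt d (d_lt_of_dominant d v ε (hθ hab) _ _ _ hda hdb j hj)).le
    have hstrict : dRank d ((p a).2 i) < dRank d ((p b).2 i) :=
      dRank_lt_of_lt d (d_lt_of_dominant d v ε (hθ hab) _ _ _ hda hdb i hi)
    unfold termRank
    exact sum_lt_sum (fun j _ => hmono j) ⟨i, mem_univ _, hstrict⟩
  have hsame : ∀ a b : Fin (n + 1), (p a).1 = (p b).1 → termRank d (p a) = termRank d (p b) → a = b := by
    intro a b h1 h2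
    rcases lt_trichotomy a b with h | h | h
    · exact absurd h2 (ne_of_lt (hkey a b h h1))
    · exact h
    · exact absurd h2.symm (ne_of_lt (hkey b a h h1.symm))
  -- (2) equal slopes ⇒ equal indices
  have hslope : ∀ a b : Fin (n + 1), TropicalCensus.slope d (p a) = TropicalCensus.slope d (p b) → a = b := by
    intro a b hs
    rcases lt_trichotomy a b with h | h | h
    · exact absurd hs (ne_of_lt (slope_lt_of_dominant d v ε (hθ h) (fun e => (ne_of_lt h) (hinj e)) (hdom a) (hdom b)))
    · exact h
    · exact absurd hs.symm (ne_of_lt (slope_lt_of_dominant d v ε (hθ h) (fun e => (ne_of_lt h) (hinj e)) (hdom b) (hdom a)))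
  -- (3) the rank profile: ranks as elements of `Fin K`, and exponent values as a function of ranks
  let rankFin : Fin K → Fin K := fun l => ⟨dRank d l, lt_of_le_of_lt (dRank_le d l) (by omega)⟩
  let g : ℕ → ℕ := fun r => if h : ∃ l : Fin K, dRank d l = r then d h.choose else 0
  have hg : ∀ l, g (dRank d l) = d l := by
    intro l
    have hex : ∃ l' : Fin K, dRank d l' = dRank d l := ⟨l, rfl⟩
    simp only [g, dif_pos hex]
    exact d_eq_of_dRank_eq d hex.choose_spec
  let S : Fin (n + 1) → Sym (Fin K) m := fun k => (classSym (p k)).map rankFin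
  have hS_sum : ∀ k, (((S k : Sym (Fin K) m) : Multiset (Fin K)).map Fin.val).sum = termRank d (p k) := by
    intro k
    simp only [S, Sym.coe_map, classSym, Sym.coe_mk, Multiset.map_map]
    rfl
  have hS_slope : ∀ k, TropicalCensus.slope d (p k) = (((S k : Sym (Fin K) m) : Multiset (Fin K)).map fun l => (g l.val : ℤ)).sum := by
    intro k
    rw [slope_eq_of_classSym]
    simp only [S, Sym.coe_map, Multiset.map_map]
    congr 1
    refine Multiset.map_congr rfl fun l _ => ?_
    simp only [Function.comp, rankFin, hg]
  have hS_inj : ∀ a b, S a = S b → a = b := by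
    intro a b h
    apply hslope
    rw [hS_slope, hS_slope, h]
  -- (4) counting by total rank
  set N := m * (K - 1) + 1 with hN
  set π : ℕ → ℕ := fun r => (univ.filter fun T : Sym (Fin K) m => ((T : Multiset (Fin K)).map Fin.val).sum = r).card with hπ
  have hmaps : Set.MapsTo (fun k => termRank d (p k)) (↑(univ : Finset (Fin (n + 1)))) (↑(range N)) := by
    intro k _
    rw [coe_range, Set.mem_Iio, hN]
    exact Nat.lt_succ_of_le (termRank_le d (p k))
  have hcount : (univ : Finset (Fin (n + 1))).card =
      ∑ r ∈ range N, (univ.filter fun k : Fin (n + 1) => termRank d (p k) = r).card :=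
    card_eq_sum_card_fiberwise hmaps
  have hfib : ∀ r, (univ.filter fun k : Fin (n + 1) => termRank d (p k) = r).card ≤ min m.factorial (π r) := by
    intro r
    refine le_min ?_ ?_
    · -- distinct permutations
      have h := card_le_card_of_injOn (s := univ.filter fun k : Fin (n + 1) => termRank d (p k) = r)
        (t := (univ : Finset (Equiv.Perm (Fin m)))) (fun k => (p k).1) (fun _ _ => mem_coe.mpr (mem_univ _)) ?_
      · rwa [card_univ, Fintype.card_perm, Fintype.card_fin] at h
      · intro a ha b hb hab
        rw [mem_coe, mem_filter] at ha hb
        exact hsame a b hab (ha.2.trans hb.2.symm)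
    · -- distinct rank profiles of total rank `r`
      refine card_le_card_of_injOn S ?_ ?_
      · intro k hk
        rw [mem_coe, mem_filter] at hk ⊢
        exact ⟨mem_univ _, by rw [hS_sum, hk.2]⟩
      · intro a _ b _ hab
        exact hS_inj a b hab
  have htot : n + 1 ≤ ∑ r ∈ range N, min m.factorial (π r) := by
    calc n + 1 = (univ : Finset (Fin (n + 1))).card := by rw [card_univ, Fintype.card_fin]
      _ = ∑ r ∈ range N, (univ.filter fun k : Fin (n + 1) => termRank d (p k) = r).card := hcount
      _ ≤ ∑ r ∈ range N, min m.factorial (π r) := sum_le_sum fun r _ => hfib r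
  show n ≤ (∑ r ∈ range N, min m.factorial (π r)) - 1
  omega

/-- **The UNSIGNED `m = 3` row, rank-profile ceiling: `T_D(3, K) ≤ 18K − 53` for every `K ≥ 4`** — the same as the signed
`tropRootLawAt_three_sharp` (val-sym-trop-p4 g3), whose proof is repeated with injectivity from `injective_of_succ_ne`.
[folklore counting; argument of p4 g3] -/
theorem tropRowD_three_sharp (K : ℕ) (hK : 4 ≤ K) : TropRowD 3 K (18 * K - 53) := by
  classical
  rcases (show K = 4 ∨ 5 ≤ K by omega) with rfl | hK5
  · -- `K = 4`: slope counting, `C(6,3) − 1 = 19 = 18·4 − 53`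
    exact tropRowD_mono (by decide) (tropRowD_choose 3 4)
  intro d v ε n θ p hθ hdom hsucc
  have hinj : Function.Injective p := injective_of_succ_ne d v ε θ p hθ hdom hsucc
  -- (1) same permutation ⇒ total rank strictly increases (as in `tropRootLawAt_thin` / `tropRootLawAt_two_sharp`)
  have hkey : ∀ a b : Fin (n + 1), a < b → (p a).1 = (p b).1 → termRank d (p a) < termRank d (p b) := by
    intro a b hab h1
    have hne : p a ≠ p b := fun h => (ne_of_lt hab) (hinj h)
    have h2 : (p a).2 ≠ (p b).2 := fun h => hne (Prod.ext h1 h)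
    obtain ⟨i, hi⟩ := Function.ne_iff.mp h2
    have hpa : p a = ((p a).1, (p a).2) := rfl
    have hpb : p b = ((p a).1, (p b).2) := by rw [h1]
    have hda : IsDominant d v ε (θ a) ((p a).1, (p a).2) := hpa ▸ hdom a
    have hdb : IsDominant d v ε (θ b) ((p a).1, (p b).2) := hpb ▸ hdom b
    have hmono : ∀ j, dRank d ((p a).2 j) ≤ dRank d ((p b).2 j) := by
      intro j
      by_cases hj : (p a).2 j = (p b).2 j
      · rw [hj]
      · exact (dRank_lt_of_lt d (d_lt_of_dominant d v ε (hθ hab) _ _ _ hda hdb j hj)).le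
    have hstrict : dRank d ((p a).2 i) < dRank d ((p b).2 i) :=
      dRank_lt_of_lt d (d_lt_of_dominant d v ε (hθ hab) _ _ _ hda hdb i hi)
    unfold termRank
    exact sum_lt_sum (fun j _ => hmono j) ⟨i, mem_univ _, hstrict⟩
  have hsame : ∀ a b : Fin (n + 1), (p a).1 = (p b).1 → termRank d (p a) = termRank d (p b) → a = b := by
    intro a b h1 h2
    rcases lt_trichotomy a b with h | h | h
    · exact absurd h2 (ne_of_lt (hkey a b h h1))
    · exact h
    · exact absurd h2.symm (ne_of_lt (hkey b a h h1.symm))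
  -- (2) equal slopes ⇒ equal indices
  have hslope : ∀ a b : Fin (n + 1), TropicalCensus.slope d (p a) = TropicalCensus.slope d (p b) → a = b := by
    intro a b hs
    rcases lt_trichotomy a b with h | h | h
    · exact absurd hs (ne_of_lt (slope_lt_of_dominant d v ε (hθ h) (fun e => (ne_of_lt h) (hinj e)) (hdom a) (hdom b)))
    · exact h
    · exact absurd hs.symm
        (ne_of_lt (slope_lt_of_dominant d v ε (hθ h) (fun e => (ne_of_lt h) (hinj e)) (hdom b) (hdom a)))
  -- (3) exponent values as a function of ranks
  let g : ℕ → ℕ := fun r => if h : ∃ l : Fin K, dRank d l = r then d h.choose else 0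
  have hg : ∀ l, g (dRank d l) = d l := by
    intro l
    have hex : ∃ l' : Fin K, dRank d l' = dRank d l := ⟨l, rfl⟩
    simp only [g, dif_pos hex]
    exact d_eq_of_dRank_eq d hex.choose_spec
  -- the rank profile of a chain term (multiset of the three column ranks) and the deficiency profile
  let key : Fin (n + 1) → Multiset ℕ := fun k =>
    {dRank d ((p k).2 0), dRank d ((p k).2 1), dRank d ((p k).2 2)}
  let key' : Fin (n + 1) → Multiset ℕ := fun k =>
    {K - 1 - dRank d ((p k).2 0), K - 1 - dRank d ((p k).2 1), K - 1 - dRank d ((p k).2 2)}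
  have hkey_slope : ∀ k, TropicalCensus.slope d (p k) = ((key k).map fun r => (g r : ℤ)).sum := by
    intro k
    rw [slope_three]
    simp only [key, Multiset.insert_eq_cons, Multiset.map_cons, Multiset.map_singleton, Multiset.sum_cons,
      Multiset.sum_singleton, hg]
    ring
  have hkey_inj : ∀ a b : Fin (n + 1), key a = key b → a = b := by
    intro a b h
    apply hslope
    rw [hkey_slope, hkey_slope, h]
  have hkk : ∀ k, key k = (key' k).map fun e => K - 1 - e := by
    intro k
    have h0 := dRank_le d ((p k).2 0)
    have h1 := dRank_le d ((p k).2 1)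
    have h2 := dRank_le d ((p k).2 2)
    simp only [key, key', Multiset.insert_eq_cons, Multiset.map_cons, Multiset.map_singleton]
    rw [Nat.sub_sub_self h0, Nat.sub_sub_self h1, Nat.sub_sub_self h2]
  have hkey'_inj : ∀ a b : Fin (n + 1), key' a = key' b → a = b := by
    intro a b h
    apply hkey_inj
    rw [hkk, hkk, h]
  -- (4) the three zones of total rank
  set S16 : Finset (Multiset ℕ) :=
    ({ {0, 0, 0}, {0, 0, 1}, {0, 0, 2}, {0, 1, 1}, {0, 0, 3}, {0, 1, 2}, {1, 1, 1}, {0, 0, 4}, {0, 1, 3}, {0, 2, 2},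
       {1, 1, 2}, {0, 0, 5}, {0, 1, 4}, {0, 2, 3}, {1, 1, 3}, {1, 2, 2} } : Finset (Multiset ℕ)) with hS16
  have hS16card : S16.card = 16 := by rw [hS16]; exact card_sixteen
  set LOW := (univ : Finset (Fin (n + 1))).filter fun k => termRank d (p k) ≤ 5 with hLOW
  set NLOW := (univ : Finset (Fin (n + 1))).filter fun k => ¬ termRank d (p k) ≤ 5 with hNLOW
  set HIGH := NLOW.filter fun k => 3 * K - 8 ≤ termRank d (p k) with hHIGH
  set MID := NLOW.filter fun k => ¬ 3 * K - 8 ≤ termRank d (p k) with hMID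
  have hsplit1 : LOW.card + NLOW.card = n + 1 := by
    rw [hLOW, hNLOW, card_filter_add_card_filter_not, card_univ, Fintype.card_fin]
  have hsplit2 : HIGH.card + MID.card = NLOW.card := by
    rw [hHIGH, hMID, card_filter_add_card_filter_not]
  -- LOW ≤ 16 : rank profiles of total ≤ 5
  have hLOWle : LOW.card ≤ 16 := by
    rw [← hS16card]
    refine card_le_card_of_injOn key ?_ ?_
    · intro k hk
      rw [mem_coe, hLOW, mem_filter] at hk
      rw [mem_coe, hS16]
      have hr := hk.2
      rw [termRank_three] at hr
      exact mem_sixteen_of_sum_le_five _ _ _ hr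
    · intro a _ b _ hab
      exact hkey_inj a b hab
  -- HIGH ≤ 16 : deficiency profiles of total ≤ 5
  have hHIGHle : HIGH.card ≤ 16 := by
    rw [← hS16card]
    refine card_le_card_of_injOn key' ?_ ?_
    · intro k hk
      rw [mem_coe, hHIGH, mem_filter] at hk
      rw [mem_coe, hS16]
      have hr := hk.2
      rw [termRank_three] at hr
      have h0 := dRank_le d ((p k).2 0)
      have h1 := dRank_le d ((p k).2 1)
      have h2 := dRank_le d ((p k).2 2)
      exact mem_sixteen_of_sum_le_five _ _ _ (by omega)
    · intro a _ b _ hab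
      exact hkey'_inj a b hab
  -- MID ≤ 6·(3K − 14) : (permutation, total rank) with total rank in [6, 3K − 8)
  have hMIDle : MID.card ≤ 6 * (3 * K - 14) := by
    have hc : ((univ : Finset (Equiv.Perm (Fin 3))) ×ˢ (Finset.Ico 6 (3 * K - 8))).card = 6 * (3 * K - 14) := by
      rw [card_product, card_univ, Fintype.card_perm, Fintype.card_fin, Nat.card_Ico]
      norm_num
      omega
    rw [← hc]
    refine card_le_card_of_injOn (fun k => ((p k).1, termRank d (p k))) ?_ ?_
    · intro k hk
      rw [mem_coe, hMID, mem_filter, hNLOW, mem_filter] at hk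
      simp only [mem_coe, mem_product, mem_Ico, mem_univ, true_and]
      constructor <;> omega
    · intro a _ b _ hab
      simp only [Prod.mk.injEq] at hab
      exact hsame a b hab.1 hab.2
  -- (5) total
  have htot : n + 1 ≤ 16 + 16 + 6 * (3 * K - 14) := by
    calc n + 1 = LOW.card + (HIGH.card + MID.card) := by rw [hsplit2, hsplit1]
      _ ≤ 16 + (16 + 6 * (3 * K - 14)) := Nat.add_le_add hLOWle (Nat.add_le_add hHIGHle hMIDle)
      _ = 16 + 16 + 6 * (3 * K - 14) := by ring
  show n ≤ 18 * K - 53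
  omega

/-- **UNSIGNED `m = 3` row of record (`K ≥ 4`)**: the minimum of slope counting `C(K+2,3) − 1`, the rank-profile row `18K − 53` and the
half-thin row `5 + ⌊27(K−1)/2⌋` — identical to the signed row of record at every `K`. [this cell] -/
theorem tropRowD_three_record4 (K : ℕ) (hK : 4 ≤ K) :
    TropRowD 3 K (min (min ((K + 3 - 1).choose 3 - 1) (18 * K - 53)) (5 + 27 * (K - 1) / 2)) := by
  rcases le_total (min ((K + 3 - 1).choose 3 - 1) (18 * K - 53)) (5 + 27 * (K - 1) / 2) with h | h
  · rw [min_eq_left h]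
    rcases le_total ((K + 3 - 1).choose 3 - 1) (18 * K - 53) with h' | h'
    · rw [min_eq_left h']; exact tropRowD_choose 3 K
    · rw [min_eq_right h']; exact tropRowD_three_sharp K hK
  · rw [min_eq_right h]; exact RefreshExclusivity.tropRowD_three_halfThin K

/-- Numerical remark: which ceiling is the minimum — counting up to `K = 6`, rank profile at `K = 7, 8, 9`, half-thin from `K = 10`
(instances `K = 7` and `K = 10`). -/
theorem three_record_switch :
    18 * 7 - 53 < (7 + 3 - 1).choose 3 - 1 ∧ 18 * 7 - 53 < 5 + 27 * (7 - 1) / 2 ∧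
    5 + 27 * (10 - 1) / 2 < 18 * 10 - 53 ∧ 5 + 27 * (10 - 1) / 2 < (10 + 3 - 1).choose 3 - 1 := by decide

end Summit.ValiantsHypothesis.ValiantsHypothesis.Theorems.KPlusLogSqLaw
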